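import Literature.AnabelianGeometry.SemiGraphs.PSCVertexQuotientNontrivialProofs
import Mathlib.Tactic.Group
import Mathlib.Topology.Algebra.Group.ClosedSubgroup
import HarnessLib

/-!
# The vertex quotients `M^unr-vert_G ↠ M^unr_G[v] ⊗ F_l` come from elementary abelian quotients of `M^unr_G`

Mochizuki, *Inter-universal Teichmüller theory I*, Remark 1.2.3 (iv), kurims manuscript p. 42: "the
inclusions `M^unr_G[v] ⊆ M^unr_G` … determine a split injection `⊕_v M^unr_G[v] ↪ M^unr_G` … [so] the
elementary abelian quotients … `φ : M^unr_G ↠ Q` … whose restriction to `M^unr-vert_G` surjects onto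
`Q` and has the same kernel as the quotient `M^unr-vert_G ↠ M^unr_G[v] ↠ M^unr_G[v] ⊗ F_l` … may be
characterized as the maximal quotients … that correspond to verticially purely totally ramified
coverings".  The EXISTENCE of such `φ` for each vertex `v` — implicit in the text (extend the vertex
quotient by zero on the complement supplied by the split injection) — is what lets the
characterization be USED to recover the vertices; this proof-only file (abc-iut cell, row
CombGC:Thm1.6(iii)/T16-L16, GAP-LEDGER G-w5d174-1) proves it over abc-iut-L3-t4 / abc-iut-w4-d052's
interface, for every datum on a profinite group granted the typed inputs
`UnrVerticialSplitInjection` (the split injection) and `UnrVertAbOfRank` (`M^unr_G[v]` is the pro-`Σ`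
completion of `ℤ^{2g(v)}`), `l ∈ Σ` prime:

* `finite_map_mk_of_pow_mem` — if a closed subgroup `A ⊇ E` with `A/E` a pro-`Σ` completion of `ℤ^r`
  maps to a quotient `Π/H` (`H ⊇ E` closed normal) killing the `l`-th powers of `A`, the image of `A` is
  FINITE (the `l`-th powers contain an open subgroup of `A/E`);
* `exists_isElemAbUnrQuotient_inf_eq_vertexQuotientKer` — **for every vertex `v` there is an
  elementary abelian quotient `M^unr_G ↠ Q` (kernel `H' = Ker_v · C`, `C` the closed complement of
  `M^unr-vert_G`) whose restriction to `M^unr-vert_G` is onto (`M^unr-vert · H' = Π`) with kernel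
  `Ker_v` (`M^unr-vert ∩ H' = Ker_v`).**

Pure profinite group theory; 0 defs; nothing here takes a side on [IUTchIII] Cor. 3.12.
[cite: Mochizuki2012, IUTchI Rmk 1.2.3(iv) p.42]
-/

noncomputable section

namespace Literature.AnabelianGeometry.SemiGraphs

namespace PSCDatum

open scoped Pointwise
open SemiGraphOfAnabelioids (IsProSigmaCompletion)

universe u

variable {P : Type u} [Group P] [TopologicalSpace P] [IsTopologicalGroup P]

/-! ### 1. `l`-th powers modulo a subgroup containing the commutators -/

omit [TopologicalSpace P] [IsTopologicalGroup P] in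
/-- Modulo a normal subgroup `H ⊇ [Π, Π]` any two elements commute. [folklore] -/
private theorem commute_mk_of_commutator_le {H : Subgroup P} [H.Normal] (hH : ⁅(⊤ : Subgroup P), ⊤⁆ ≤ H)
    (x y : P) : Commute (QuotientGroup.mk x : P ⧸ H) (QuotientGroup.mk y) := by
  rw [Commute, SemiconjBy, ← QuotientGroup.mk_mul, ← QuotientGroup.mk_mul, QuotientGroup.eq]
  have hmem : y⁻¹ * x⁻¹ * y⁻¹⁻¹ * x⁻¹⁻¹ ∈ H :=
    hH (Subgroup.commutator_mem_commutator (Subgroup.mem_top y⁻¹) (Subgroup.mem_top x⁻¹))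
  have : (x * y)⁻¹ * (y * x) = y⁻¹ * x⁻¹ * y⁻¹⁻¹ * x⁻¹⁻¹ := by group
  rw [this]
  exact hmem

omit [TopologicalSpace P] [IsTopologicalGroup P] in
/-- Modulo a normal subgroup `H ⊇ [Π, Π]`: `(x y)^l ∈ H` as soon as `x^l, y^l ∈ H`. [folklore] -/
private theorem mul_pow_mem_of_commutator_le_top {H : Subgroup P} [H.Normal] (hH : ⁅(⊤ : Subgroup P), ⊤⁆ ≤ H)
    {l : ℕ} {x y : P} (hx : x ^ l ∈ H) (hy : y ^ l ∈ H) : (x * y) ^ l ∈ H := by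
  rw [← QuotientGroup.eq_one_iff, QuotientGroup.mk_pow] at hx hy ⊢
  rw [QuotientGroup.mk_mul, (commute_mk_of_commutator_le hH x y).mul_pow, hx, hy, one_mul]

/-! ### 2. The `l`-th powers of a pro-`Σ` completion of `ℤ^r` contain an open subgroup -/

section Powers

variable [CompactSpace P] [T2Space P]

omit [T2Space P] in
/-- **Finiteness of the image of `A` in a quotient killing its `l`-th powers.**  Let `E ⊆ A` be closed
subgroups of the profinite `Π` with `A/E` a pro-`Σ` completion of `ℤ^r` (as in abc-iut-w4-d052's
`UnrVertAbOfRank`), `l ∈ Σ` prime, and `H ⊇ E` a closed normal subgroup containing `a^l` for all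
`a ∈ A`.  Then the image of `A` in `Π/H` is finite: the `l`-th powers of `A/E` form a closed set
containing the image of `l·ℤ^r`, hence (density) the open subgroup of `A/E` lying over `l·ℤ^r`.
[cite: Mochizuki2012, IUTchI Rmk 1.2.3(iv) p.42] -/
theorem finite_map_mk_of_pow_mem {Sigma : Set ℕ} {A E : Subgroup P}
    [(E.subgroupOf A).Normal] (hAc : IsClosed (A : Set P)) (hEc : IsClosed (E : Set P)) {r : ℕ}
    {ι : Multiplicative (Fin r → ℤ) →* A ⧸ E.subgroupOf A} (hι : IsProSigmaCompletion Sigma ι)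
    {l : ℕ} (hl : l.Prime) (hlS : l ∈ Sigma) {H : Subgroup P} [H.Normal] (hEH : E ≤ H)
    (hpow : ∀ a ∈ A, a ^ l ∈ H) :
    ((A.map (QuotientGroup.mk' H) : Subgroup (P ⧸ H)) : Set (P ⧸ H)).Finite := by
  haveI : CompactSpace A := isCompact_iff_compactSpace.mp hAc.isCompact
  haveI : IsClosed ((E.subgroupOf A : Subgroup A) : Set A) := by
    rw [Subgroup.coe_subgroupOf]; exact hEc.preimage continuous_subtype_val
  haveI : NeZero l := ⟨hl.ne_zero⟩
  -- `φ : A → Π/H` factors through `Q = A/E`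
  let φ : A →* P ⧸ H := (QuotientGroup.mk' H).comp A.subtype
  have hker : E.subgroupOf A ≤ φ.ker := by
    intro a ha
    rw [Subgroup.mem_subgroupOf] at ha
    rw [MonoidHom.mem_ker]
    exact (QuotientGroup.eq_one_iff _).mpr (hEH ha)
  let ψ : A ⧸ E.subgroupOf A →* P ⧸ H := QuotientGroup.lift _ φ hker
  -- the lattice `N = l·ℤ^r`, of index `l^r`
  let f : (Fin r → ℤ) →+ (Fin r → ZMod l) := (Int.castAddHom (ZMod l)).compLeft (Fin r)
  have hf : Function.Surjective f := fun y => ⟨fun i => (y i).val, by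
    ext i; simp [f, AddMonoidHom.compLeft]⟩
  let N : Subgroup (Multiplicative (Fin r → ℤ)) := AddSubgroup.toSubgroup f.ker
  have hmemN : ∀ γ : Multiplicative (Fin r → ℤ), γ ∈ N ↔ ∀ i, (l : ℤ) ∣ Multiplicative.toAdd γ i := by
    intro γ
    rw [Multiplicative.mem_toSubgroup, AddMonoidHom.mem_ker, funext_iff]
    refine forall_congr' fun i => ?_
    rw [Pi.zero_apply]
    exact ZMod.intCast_zmod_eq_zero_iff_dvd _ _
  have hNidx : N.index = l ^ r := by
    rw [AddSubgroup.index_toSubgroup, AddSubgroup.index_ker, AddMonoidHom.range_eq_top.mpr hf,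
      AddSubgroup.card_top, Nat.card_fun, Nat.card_zmod, Nat.card_eq_fintype_card, Fintype.card_fin]
  haveI : N.Normal := inferInstance
  obtain ⟨W, hWo, hWN⟩ := hι.comap_surj N inferInstance (by
    rw [hNidx]; exact SemiGraphOfAnabelioids.IsProSigmaCompletion.isSigmaInteger_prime_pow hl hlS r)
  -- the `l`-th powers of `Q` form a closed set containing `W`
  set S : Set (A ⧸ E.subgroupOf A) := Set.range fun q : A ⧸ E.subgroupOf A => q ^ l with hS
  have hSc : IsClosed S := (isCompact_range (continuous_id.pow l)).isClosed
  have hιN : (ι : Multiplicative (Fin r → ℤ) → A ⧸ E.subgroupOf A) '' (N : Set _) ⊆ S := by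
    rintro _ ⟨γ, hγ, rfl⟩
    rw [SetLike.mem_coe, hmemN] at hγ
    choose c hc using hγ
    refine ⟨ι (Multiplicative.ofAdd c), ?_⟩
    show ι (Multiplicative.ofAdd c) ^ l = ι γ
    rw [← map_pow]
    congr 1
    apply Multiplicative.toAdd.injective
    rw [toAdd_pow, toAdd_ofAdd]
    funext i
    rw [Pi.smul_apply, hc i, nsmul_eq_mul]
  have hWS : (W : Set (A ⧸ E.subgroupOf A)) ⊆ S := by
    have h1 : (W : Set _) ⊆ closure ((W : Set _) ∩ Set.range ι) :=
      hι.dense.open_subset_closure_inter hWo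
    have h2 : (W : Set _) ∩ Set.range ι = ι '' (N : Set _) := by
      rw [← hWN, Subgroup.coe_comap, Set.image_preimage_eq_inter_range]
    rw [h2] at h1
    exact h1.trans (hSc.closure_subset_iff.mpr hιN)
  -- `S ⊆ ker ψ`, so `W ≤ ker ψ` and `ker ψ` has finite index
  have hSker : S ⊆ (ψ.ker : Set _) := by
    rintro _ ⟨q, rfl⟩
    induction q using QuotientGroup.induction_on with
    | H a =>
      rw [SetLike.mem_coe, MonoidHom.mem_ker, map_pow, QuotientGroup.lift_mk]
      change ((QuotientGroup.mk' H) (a : P)) ^ l = 1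
      rw [← map_pow, QuotientGroup.mk'_apply, QuotientGroup.eq_one_iff]
      exact hpow a a.2
  have hWker : W ≤ ψ.ker := fun q hq => hSker (hWS hq)
  haveI : W.FiniteIndex := by
    haveI : DiscreteTopology ((A ⧸ E.subgroupOf A) ⧸ W) := QuotientGroup.discreteTopology hWo
    haveI : Finite ((A ⧸ E.subgroupOf A) ⧸ W) := finite_of_compact_of_discrete
    exact Subgroup.finiteIndex_of_finite_quotient
  haveI : ψ.ker.FiniteIndex := Subgroup.finiteIndex_of_le hWker
  have hfin : (ψ.range : Set (P ⧸ H)).Finite := by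
    have h := Subgroup.index_ker ψ
    have hne : Nat.card ψ.range ≠ 0 := h ▸ Subgroup.FiniteIndex.index_ne_zero
    exact Nat.finite_of_card_ne_zero hne
  -- `range ψ = range φ = A.map mk`
  refine hfin.subset ?_
  rintro _ ⟨a, ha, rfl⟩
  exact ⟨QuotientGroup.mk (⟨a, ha⟩ : A), (QuotientGroup.lift_mk _ hker _).trans rfl⟩

end Powers

/-! ### 3. Existence of the elementary abelian quotient attached to a vertex -/

section Existence

variable [CompactSpace P] [T2Space P]

/-- **[IUTchI] Rmk. 1.2.3 (iv): for every vertex `v` there IS an elementary abelian quotient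
`φ_v : M^unr_G ↠ Q` whose restriction to `M^unr-vert_G` is onto with the same kernel as
`M^unr-vert_G ↠ M^unr_G[v] ⊗ F_l`** — over the interface: an `H'` with `IsElemAbUnrQuotient l H'`,
`M^unr-vert · H' = Π_G` and `M^unr-vert ∩ H' = Ker_v` (preimages).  Granted the split injection
`⊕_w M^unr_G[w] ↪ M^unr_G` (`UnrVerticialSplitInjection`: independence + a closed complement `C`) and
the rank of `M^unr_G[v]` (`UnrVertAbOfRank`), for sturdy `G` on a profinite group and a prime `l ∈ Σ`:
take `H' := Ker_v · C`; it is open because `M^unr_G[v] / (l·M^unr_G[v] + E)` is finite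
(`finite_map_mk_of_pow_mem`). [cite: Mochizuki2012, IUTchI Rmk 1.2.3(iv) p.42] -/
theorem exists_isElemAbUnrQuotient_inf_eq_vertexQuotientKer (G : PSCDatum P)
    (hsplit : G.UnrVerticialSplitInjection) (hrank : G.UnrVertAbOfRank) (hGs : G.IsSturdy)
    {l : ℕ} (hl : l.Prime) (hlS : l ∈ G.Sigma) (v : G.graph.V) :
    ∃ H' : Subgroup P, G.IsElemAbUnrQuotient l H' ∧ G.unrVertAb ⊔ H' = ⊤ ∧
      G.unrVertAb ⊓ H' = G.vertexQuotientKer l v := by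
  have hA_def : G.unrVertAb = (⨆ w, G.unrVertAbOf w).topologicalClosure := rfl
  obtain ⟨-, C, hCc, hEC, hCA, hCA'⟩ := hsplit hGs
  rw [← hA_def] at hCA hCA'
  -- the vertex kernel `K = Ker_v`, made opaque
  obtain ⟨K, hK⟩ : ∃ K : Subgroup P, G.vertexQuotientKer l v = K := ⟨_, rfl⟩
  have hcommE : ⁅(⊤ : Subgroup P), ⊤⁆ ≤ G.unrAbKer := G.commutator_le_unrAbKer
  have hEK : G.unrAbKer ≤ K := by
    rw [← hK]
    exact (le_sup_left.trans le_sup_left).trans (Subgroup.le_topologicalClosure _)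
  have hKA : K ≤ G.unrVertAb := hK ▸ G.vertexQuotientKer_le_unrVertAb l v
  have hKc : IsClosed (K : Set P) := hK ▸ Subgroup.isClosed_topologicalClosure _
  have hwK : ∀ w : G.graph.V, w ≠ v → G.unrVertAbOf w ≤ K := by
    intro w hw
    rw [← hK]
    refine (Subgroup.le_topologicalClosure _).trans' (le_sup_left.trans' (le_sup_right.trans' ?_))
    exact le_iSup_of_le ⟨w, hw⟩ le_rfl
  have hpowK : ∀ a ∈ G.unrVertAbOf v, a ^ l ∈ K := by
    intro a ha
    rw [← hK]
    refine Subgroup.le_topologicalClosure _ (Subgroup.mem_sup_right (Subgroup.subset_closure ?_))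
    exact ⟨a, ha, rfl⟩
  have hAc : IsClosed (G.unrVertAb : Set P) := Subgroup.isClosed_topologicalClosure _
  have hEc : IsClosed (G.unrAbKer : Set P) := Subgroup.isClosed_topologicalClosure _
  haveI hEn : G.unrAbKer.Normal := normal_of_commutator_le hcommE
  haveI hKn : K.Normal := normal_of_commutator_le (hcommE.trans hEK)
  haveI hCn : C.Normal := normal_of_commutator_le (hcommE.trans hEC)
  -- the candidate kernel `H' = K · C`
  haveI hH'n : (K ⊔ C).Normal := Subgroup.sup_normal K C
  have hH'c : IsClosed ((K ⊔ C : Subgroup P) : Set P) := by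
    rw [Subgroup.normal_mul, ← Set.image_mul_prod]
    exact ((hKc.isCompact.prod hCc.isCompact).image continuous_mul).isClosed
  have hcommH' : ⁅(⊤ : Subgroup P), ⊤⁆ ≤ K ⊔ C := (hcommE.trans hEK).trans le_sup_left
  have hsup : G.unrVertAb ⊔ (K ⊔ C) = ⊤ :=
    top_le_iff.mp (hCA'.symm.le.trans (sup_le (le_sup_right.trans le_sup_right) le_sup_left))
  have hinf : G.unrVertAb ⊓ (K ⊔ C) = K := by
    refine le_antisymm ?_ (le_inf hKA le_sup_left)
    rintro x ⟨hxA, hxKC⟩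
    have hx' : x ∈ ((K ⊔ C : Subgroup P) : Set P) := hxKC
    rw [Subgroup.normal_mul] at hx'
    obtain ⟨k, hk, c, hc, rfl⟩ := hx'
    have hcA : c ∈ G.unrVertAb := by
      have := G.unrVertAb.mul_mem (G.unrVertAb.inv_mem (hKA hk)) hxA
      rwa [inv_mul_cancel_left] at this
    have hcE : c ∈ G.unrAbKer := by rw [← hCA]; exact ⟨hc, hcA⟩
    exact K.mul_mem hk (hEK hcE)
  -- every `l`-th power lies in `H'`
  have hpowA : ∀ a ∈ G.unrVertAbOf v, a ^ l ∈ K ⊔ C := fun a ha => Subgroup.mem_sup_left (hpowK a ha)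
  have hpow : ∀ g : P, g ^ l ∈ K ⊔ C := by
    let T : Subgroup P :=
      { carrier := {g : P | g ^ l ∈ K ⊔ C}
        one_mem' := by simp only [Set.mem_setOf_eq, one_pow]; exact one_mem _
        mul_mem' := fun hx hy => mul_pow_mem_of_commutator_le_top hcommH' hx hy
        inv_mem' := fun hx => by
          simp only [Set.mem_setOf_eq, inv_pow] at hx ⊢
          exact inv_mem hx }
    have hTc : IsClosed (T : Set P) := hH'c.preimage (continuous_id.pow l)
    have hCT : C ≤ T := by
      intro c hc
      show c ^ l ∈ K ⊔ C
      exact Subgroup.mem_sup_right (pow_mem hc l)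
    have hAT : G.unrVertAb ≤ T := by
      rw [hA_def]
      refine Subgroup.topologicalClosure_minimal _ (iSup_le fun w => ?_) hTc
      intro a ha
      show a ^ l ∈ K ⊔ C
      by_cases hw : w = v
      · subst hw
        exact hpowA a ha
      · exact Subgroup.mem_sup_left (pow_mem (hwK w hw ha) l)
    intro g
    have h : C ⊔ G.unrVertAb ≤ T := sup_le hCT hAT
    rw [hCA'] at h
    exact h (Subgroup.mem_top g)
  -- `H'` is open: `Π/H'` is the finite image of `M^unr_G[v]`
  have hopen : IsOpen ((K ⊔ C : Subgroup P) : Set P) := by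
    haveI : IsClosed ((K ⊔ C : Subgroup P) : Set P) := hH'c
    haveI : (G.unrAbKer.subgroupOf (G.unrVertAbOf v)).Normal := inferInstance
    obtain ⟨ι, hι⟩ := hrank v
    have hfin := finite_map_mk_of_pow_mem (A := G.unrVertAbOf v) (Subgroup.isClosed_topologicalClosure _)
      hEc hι hl hlS (H := K ⊔ C) (hEK.trans le_sup_left) hpowA
    have hsub : (Set.univ : Set (P ⧸ (K ⊔ C))) ⊆
        ((G.unrVertAbOf v).map (QuotientGroup.mk' (K ⊔ C)) : Set (P ⧸ (K ⊔ C))) := by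
      intro q _
      obtain ⟨g, rfl⟩ := QuotientGroup.mk_surjective q
      have hg : g ∈ ((G.unrVertAb ⊔ (K ⊔ C) : Subgroup P) : Set P) := by
        rw [hsup]; exact Subgroup.mem_top g
      rw [Subgroup.mul_normal] at hg
      obtain ⟨a, ha, h, hh, rfl⟩ := hg
      have e1 : (QuotientGroup.mk (a * h) : P ⧸ (K ⊔ C)) = QuotientGroup.mk a := by
        rw [QuotientGroup.mk_mul, (QuotientGroup.eq_one_iff h).mpr hh, mul_one]
      rw [e1]
      -- `mk a ∈ closure (mk '' ⨆ A_w) ⊆ mk '' A_v` (a finite, hence closed, set)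
      have h1 : (QuotientGroup.mk a : P ⧸ (K ⊔ C)) ∈
          closure ((QuotientGroup.mk : P → P ⧸ (K ⊔ C)) ''
            ((⨆ w, G.unrVertAbOf w : Subgroup P) : Set P)) := by
        refine image_closure_subset_closure_image QuotientGroup.continuous_mk ⟨a, ?_, rfl⟩
        rw [hA_def] at ha
        exact ha
      have h2 : (QuotientGroup.mk : P → P ⧸ (K ⊔ C)) '' ((⨆ w, G.unrVertAbOf w : Subgroup P) : Set P) ⊆
          ((G.unrVertAbOf v).map (QuotientGroup.mk' (K ⊔ C)) : Set (P ⧸ (K ⊔ C))) := by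
        rw [← QuotientGroup.coe_mk', ← Subgroup.coe_map, SetLike.coe_subset_coe, Subgroup.map_iSup]
        refine iSup_le fun w => ?_
        by_cases hw : w = v
        · subst hw; exact le_rfl
        · rw [(Subgroup.map_eq_bot_iff _).mpr (by rw [QuotientGroup.ker_mk']; exact (hwK w hw).trans le_sup_left)]
          exact bot_le
      exact closure_minimal h2 hfin.isClosed h1
    haveI : Finite (P ⧸ (K ⊔ C)) := Set.finite_univ_iff.mp (hfin.subset hsub)
    haveI : (K ⊔ C).FiniteIndex := Subgroup.finiteIndex_of_finite_quotient
    exact Subgroup.isOpen_of_isClosed_of_finiteIndex _ hH'c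
  rw [hK]
  exact ⟨K ⊔ C, ⟨hH'n, hopen, hEK.trans le_sup_left, hpow⟩, hsup, hinf⟩

end Existence

end PSCDatum

end Literature.AnabelianGeometry.SemiGraphs

end
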